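import Literature.Probability.LatticeModels.FKIsingQuadrilateralCrossing
import Literature.Analysis.Potential.HarmonicMeasureHarmonicMajorant
import Literature.Analysis.Complex.HalfPlaneTwoArcHarmonic
import Literature.Analysis.Complex.UnivalentSequenceLimits
import Literature.Probability.RandomPlanarGeometry.InverseBoundaryCorrespondence
import HarnessLib

/-!
# Chelkak–Smirnov's crossing theorem: the harmonic-measure hypothesis in half-plane coordinates

Sibling of `Literature.Probability.LatticeModels.FKIsingQuadrilateralCrossing` (the named fact
`ChelkakSmirnov2012_fkIsingQuadrilateralCrossing` = D. Chelkak, S. Smirnov, Invent. Math. 189 (2012),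
Thm. 6.1, square lattice) and of `FKIsingQuadrilateralCrossingProofs.lean` (proved bricks of the
printed proof). Thm. 6.1 assumes "`ω(0; Ω^δ; a^δ b^δ), ω(0; Ω^δ; c^δ d^δ) ≥ t` (or the other pair)",
`ω` the harmonic measure in the polygonal domain `Ω^δ` (loc. cit. §4), which in the proof guarantees
that the limiting quadrilateral has no pair of neighbouring degenerate arcs ("It follows from our
assumptions that … either `a ≠ b`, `c ≠ d` or `b ≠ c`, `d ≠ a`", p. 27). In the tree's statement the
harmonic measure is the Perron one (`Literature.Analysis.Potential.harmonicMeasure`) and the conformal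
structure enters through a uniformizing map `φ : ℍ → Ω^δ`; this file proves the bridge between the
two, everything proved:

* `hmInterval α β` — the harmonic measure `ω_ℍ(z; (α, β)) = (arg(z-β) - arg(z-α))/π` of a real
  interval seen from the upper half-plane: harmonic, `|·| ≤ 2`, boundary values `1` on `(α, β)`
  and `0` off `[α, β]`, non-negative on `ℍ` (Lindelöf's principle);
* `harmonicMeasure_le_hmInterval` — **for a bounded open `U`, a conformal equivalence
  `φ : ℍ → U` and a set `B` at whose points (finitely many excepted) `φ⁻¹` tends to points of
  `(α, β)`, `ω_U(z, B) ≤ ω_ℍ(φ⁻¹ z; (α, β))`** (the harmonic majorant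
  `ω_ℍ(·; (α, β)) ∘ φ⁻¹`, `Literature.Analysis.Potential.harmonicMeasure_le_of_harmonicOnNhd`, and
  "harmonic ∘ holomorphic is harmonic", `Literature.Analysis.Complex.harmonicOnNhd_comp_of_differentiableOn`).
  So `ω_U(z₀, B) ≥ t` forces the preimage interval of the arc `B` to subtend an angle `≥ π t` at
  `φ⁻¹(z₀)` — the quantitative non-degeneracy used in the compactness step of the proof of Thm. 6.1.
  The boundary-correspondence hypothesis is what Carathéodory's theorem supplies for the Jordan
  polygon `Ω^δ` (`Literature.Probability.RandomPlanarGeometry.JordanDomain.exists_continuousOn_extension_holds`);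
* `harmonicMeasure_image_boundaryExtension_le` — the two combined for a JORDAN DOMAIN `D` and a
  uniformizing map `φ : ℍ → D`: the harmonic measure of the boundary arc
  `φ.boundaryExtension((α, β)) ⊆ ∂D` seen from `z ∈ D` is at most `ω_ℍ(φ⁻¹ z; (α, β))`
  (inverse boundary correspondence, `JordanDomain.exists_tendsto_symm_of_mem_image` of
  `InverseBoundaryCorrespondence.lean`, Pommerenke Thm. 2.6).

## References
* [ChelkakSmirnov2012Ising] D. Chelkak, S. Smirnov, Invent. Math. 189 (2012), §4 (harmonic measure
  in `Ω^δ`), §6 Thm. 6.1 and p. 27 of arXiv:0910.2045 (READ).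
* [Ransford1995] T. Ransford, *Potential Theory in the Complex Plane* (1995), Def. 4.1.1, Lemma 4.1.6.
* [Conway1978] J. B. Conway, *Functions of One Complex Variable* (1978), Ch. X §1 (Lindelöf).
-/

noncomputable section

open Filter Set Complex
open scoped Topology

namespace Literature.Probability.LatticeModels

open Literature.Probability.RandomPlanarGeometry (ConformalEquiv)
open Literature.Analysis.Potential (harmonicMeasure)
open UpperHalfPlane (upperHalfPlaneSet)
open InnerProductSpace (HarmonicOnNhd HarmonicAt)

/-- **The harmonic measure of the real interval `(α, β)` seen from `z ∈ ℍ`**: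
`ω_ℍ(z; (α, β)) = (arg(z - β) - arg(z - α))/π`, the angle subtended by the segment over `π`.
[folklore] -/
def hmInterval (α β : ℝ) (z : ℂ) : ℝ := (arg (z - β) - arg (z - α)) / Real.pi

/-- `ω_ℍ(·; (α, β))` is harmonic on `ℍ`. [folklore] -/
theorem hmInterval_harmonicOnNhd (α β : ℝ) : HarmonicOnNhd (hmInterval α β) upperHalfPlaneSet := by
  have h1 := Literature.Analysis.Complex.harmonicOnNhd_arg_sub_ofReal β
  have h2 := Literature.Analysis.Complex.harmonicOnNhd_arg_sub_ofReal α
  have h3 := (h1.sub h2).const_smul (c := Real.pi⁻¹)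
  have heq : hmInterval α β = Real.pi⁻¹ • ((fun w : ℂ ↦ arg (w - β)) - fun w : ℂ ↦ arg (w - α)) := by
    funext w
    simp only [hmInterval, Pi.smul_apply, Pi.sub_apply, smul_eq_mul]
    ring
  rw [heq]; exact h3

/-- `|ω_ℍ(z; (α, β))| ≤ 2`. [folklore] -/
theorem abs_hmInterval_le (α β : ℝ) (z : ℂ) : |hmInterval α β z| ≤ 2 := by
  rw [hmInterval, abs_div, abs_of_pos Real.pi_pos, div_le_iff₀ Real.pi_pos]
  calc |arg (z - β) - arg (z - α)| ≤ |arg (z - β)| + |arg (z - α)| := abs_sub _ _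
    _ ≤ Real.pi + Real.pi := add_le_add (abs_arg_le_pi _) (abs_arg_le_pi _)
    _ = 2 * Real.pi := by ring

/-- Boundary values `1` on `(α, β)`. [folklore] -/
theorem hmInterval_tendsto_one {α β x : ℝ} (hαx : α < x) (hxβ : x < β) :
    Tendsto (hmInterval α β) (𝓝[upperHalfPlaneSet] (x : ℂ)) (𝓝 1) := by
  have h := ((Literature.Analysis.Complex.tendsto_arg_sub_of_gt hxβ).sub (Literature.Analysis.Complex.tendsto_arg_sub_of_lt hαx)).div_const Real.pi
  rw [sub_zero, div_self Real.pi_pos.ne'] at h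
  exact h

/-- Boundary values `0` to the right of `β`. [folklore] -/
theorem hmInterval_tendsto_zero_of_gt {α β x : ℝ} (hαβ : α ≤ β) (hx : β < x) :
    Tendsto (hmInterval α β) (𝓝[upperHalfPlaneSet] (x : ℂ)) (𝓝 0) := by
  have h := ((Literature.Analysis.Complex.tendsto_arg_sub_of_lt hx).sub
    (Literature.Analysis.Complex.tendsto_arg_sub_of_lt (hαβ.trans_lt hx))).div_const
    Real.pi
  rw [sub_zero, zero_div] at h
  exact h

/-- Boundary values `0` to the left of `α`. [folklore] -/
theorem hmInterval_tendsto_zero_of_lt {α β x : ℝ} (hαβ : α ≤ β) (hx : x < α) :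
    Tendsto (hmInterval α β) (𝓝[upperHalfPlaneSet] (x : ℂ)) (𝓝 0) := by
  have h := ((Literature.Analysis.Complex.tendsto_arg_sub_of_gt (hx.trans_le hαβ)).sub
    (Literature.Analysis.Complex.tendsto_arg_sub_of_gt hx)).div_const
    Real.pi
  rw [sub_self, zero_div] at h
  exact h

/-- `ω_ℍ(·; (α, β)) ≥ 0` on `ℍ` (Lindelöf's maximum principle applied to `-ω`, whose boundary values
are `0` and `-1` off `{α, β}`). [folklore] -/
theorem hmInterval_nonneg {α β : ℝ} (hαβ : α < β) {z : ℂ} (hz : z ∈ upperHalfPlaneSet) :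
    0 ≤ hmInterval α β z := by
  classical
  have h := Literature.Analysis.Complex.harmonic_le_of_real_except (u := fun w ↦ -hmInterval α β w)
    (hmInterval_harmonicOnNhd α β).neg (B := 2) (M := 0)
    (fun w _ ↦ by have := abs_hmInterval_le α β w; rw [abs_le] at this; linarith [this.1])
    ({α, β} : Finset ℝ) ?_ z hz
  · linarith
  intro x hx ε hε
  simp only [Finset.mem_insert, Finset.mem_singleton, not_or] at hx
  have hlim : ∃ c : ℝ, 0 ≤ c ∧ Tendsto (hmInterval α β) (𝓝[upperHalfPlaneSet] (x : ℂ)) (𝓝 c) := by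
    rcases lt_or_gt_of_ne hx.1 with h1 | h1
    · exact ⟨0, le_rfl, hmInterval_tendsto_zero_of_lt hαβ.le h1⟩
    rcases lt_or_gt_of_ne hx.2 with h2 | h2
    · exact ⟨1, zero_le_one, hmInterval_tendsto_one h1 h2⟩
    · exact ⟨0, le_rfl, hmInterval_tendsto_zero_of_gt hαβ.le h2⟩
  obtain ⟨c, hc, hl⟩ := hlim
  have : ∀ᶠ w in 𝓝[upperHalfPlaneSet] (x : ℂ), c - ε < hmInterval α β w :=
    hl (Ioi_mem_nhds (by linarith))
  exact this.mono fun w hw ↦ by linarith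

/-- **Harmonic measure of a boundary arc is dominated by the angle its preimage subtends.** Let
`U` be a bounded open set, `φ : ℍ → U` a conformal equivalence, `B ⊆ ℂ` (a boundary arc) and
`α < β` real; suppose that at every point `ζ ∈ B` outside a finite set `T` of points off `U` the
inverse map `φ⁻¹` tends to a point of the open interval `(α, β)` (boundary correspondence on the
arc). Then `ω_U(z, B) ≤ ω_ℍ(φ⁻¹ z; (α, β))` for `z ∈ U`: the harmonic measure hypotheses
`ω(0; Ω^δ; arc) ≥ t` of Thm. 6.1 thus bound from below the angles subtended at `φ⁻¹(z₀)` by the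
preimages of the arcs. [cite: ChelkakSmirnov2012Ising, §4 (ω(0; Ω^δ; ·)) and Thm. 6.1 (hypotheses);
Ransford1995, Def. 4.1.1 / Lemma 4.1.6 via `harmonicMeasure_le_of_harmonicOnNhd`] -/
theorem harmonicMeasure_le_hmInterval {U : Set ℂ} (hU : IsOpen U) (hUb : Bornology.IsBounded U)
    (φ : ConformalEquiv upperHalfPlaneSet U) {α β : ℝ} (hαβ : α < β) {B : Set ℂ} (T : Finset ℂ)
    (hT : ∀ p ∈ T, p ∉ U)
    (hcorr : ∀ ζ ∈ B, ζ ∉ T → ∃ x : ℝ, α < x ∧ x < β ∧ Tendsto φ.symm (𝓝[U] ζ) (𝓝 (x : ℂ)))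
    {z : ℂ} (hz : z ∈ U) : harmonicMeasure U z B ≤ hmInterval α β (φ.symm z) := by
  set h : ℂ → ℝ := fun w ↦ hmInterval α β (φ.symm w) with hh
  have hharm : HarmonicOnNhd h U :=
    Literature.Analysis.Complex.harmonicOnNhd_comp_of_differentiableOn (hmInterval_harmonicOnNhd α β)
      UpperHalfPlane.isOpen_upperHalfPlaneSet φ.symm.differentiableOn_coe hU φ.symm_mapsTo
  have h0 : ∀ w ∈ U, 0 ≤ h w := fun w hw ↦ hmInterval_nonneg hαβ (φ.symm_mapsTo hw)
  refine Literature.Analysis.Potential.harmonicMeasure_le_of_harmonicOnNhd hU hUb hharm h0 T hT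
    (fun ζ hζ hζT ε hε ↦ ?_) hz
  obtain ⟨x, hαx, hxβ, hlim⟩ := hcorr ζ hζ hζT
  have hlim' : Tendsto φ.symm (𝓝[U] ζ) (𝓝[upperHalfPlaneSet] (x : ℂ)) :=
    tendsto_nhdsWithin_iff.2 ⟨hlim, eventually_mem_nhdsWithin.mono fun w hw ↦ φ.symm_mapsTo hw⟩
  have := (hmInterval_tendsto_one hαx hxβ).comp hlim'
  have hev : ∀ᶠ w in 𝓝[U] ζ, 1 - ε < h w := this (Ioi_mem_nhds (by linarith))
  exact hev.mono fun w hw ↦ hw.le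


/-- **Harmonic measure of a boundary arc of a Jordan domain, seen through a uniformizing map.**
For a Jordan domain `D`, a conformal equivalence `φ : ℍ → D` and `α < β`, the Perron harmonic
measure of the arc `φ.boundaryExtension((α, β)) ⊆ ∂D` from `z ∈ D` is at most the angle
`ω_ℍ(φ⁻¹ z; (α, β))`; so the hypothesis `ω(z₀; Ω^δ; arc) ≥ t` of Thm. 6.1 forces the preimage
interval of the arc to subtend an angle `≥ π t` at `φ⁻¹(z₀)`. (Carathéodory's theorem, through
`JordanDomain.exists_tendsto_symm_of_mem_image`, supplies the boundary correspondence.)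
[cite: ChelkakSmirnov2012Ising, §4 and Thm. 6.1 (hypotheses); PommerenkeBBCM1992, Thm. 2.6] -/
theorem harmonicMeasure_image_boundaryExtension_le
    (D : Literature.Probability.RandomPlanarGeometry.JordanDomain)
    (φ : ConformalEquiv upperHalfPlaneSet D.carrier) {α β : ℝ} (hαβ : α < β) {z : ℂ}
    (hz : z ∈ D.carrier) :
    harmonicMeasure D.carrier z (φ.boundaryExtension '' ((fun x : ℝ ↦ (x : ℂ)) '' Ioo α β)) ≤
      hmInterval α β (φ.symm z) :=
  harmonicMeasure_le_hmInterval D.isOpen D.isBounded φ hαβ ∅ (by simp)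
    (fun _ hζ _ ↦ Literature.Probability.RandomPlanarGeometry.JordanDomain.exists_tendsto_symm_of_mem_image
      D φ hζ) hz

end Literature.Probability.LatticeModels
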